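import Literature.NumberTheory.LFunctions.BurnolClosureCriterionProofs
import Mathlib.Analysis.Fourier.PoissonSummation
import Mathlib.Analysis.Fourier.Inversion
import Mathlib.MeasureTheory.Function.JacobianOneDim
import HarnessLib

/-!
# Burnol 2001, Thm 2.8 (the causality criterion for `ζ`): `E(𝒮_{≤1})^⊥ ⊂ cl E(𝓕(𝒮_{≤1})) ⟺ RH` — DISCHARGED

LABEL (line 1): RH-EQUIVALENT·PRINTED criterion proved AS AN EQUIVALENCE (neither side asserted).
`Literature.NumberTheory.LFunctions.Burnol2001_thm_2_8` — the `ζ`-case of Burnol's causality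
criterion Thm 1.7 (`𝒟₋ ⊥ 𝒟₊ ⟺ RH`, outgoing space `𝒟₊ = E(𝒮_{≤1})^⊥`, incoming space
`𝒟₋ = E(𝓕(𝒮_{≤1}))^⊥`), typed as "every `g ∈ L²((0,∞), du)` orthogonal to all `E(φ)`,
`φ ∈ 𝒮_{≤1}`, is an `L²((0,∞))`-limit of functions `E(𝓕φ)`, `φ ∈ 𝒮_{≤1}`, iff RH" — is
discharged here as `Burnol2001_thm_2_8_holds`: the `closure ⟹ RH` half is
`riemannHypothesis_of_causality`, the `RH ⟹ closure` half is
`causality_closure_of_riemannHypothesis`. bears_on: LADDER-RH B-C/B-P (COLUMN 6 DBR). WHAT THIS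
IS NOT: a proof or disproof of RH — an equivalence fixes WHICH orthogonality statement is RH, it
does not move RH; nothing here bears on the truth of RH.

Source: J.-F. Burnol, *An adelic causality problem related to abelian L-functions*, J. Number
Theory 87 (2001) 253–269 = arXiv:math/0001013v3 [Burnol2001], §2, TeX l.464–519 (the map `E`,
its Poisson formula l.466–469, Thm 2.7, the spaces `𝒟₊`, `𝒟₋ = I(𝒟₊)` l.500–508, Thm 2.8
l.516–519) and §3 l.522–524 ("the Poisson–Tate formula gives `E·𝓕 = I·E`").

## The printed proof and the road followed here

Burnol (l.500–515) reads Thm 2.8 off the Beurling–Lax description of the closed dilation-invariant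
subspaces of `ℍ²`: `𝒟₊ = E(𝒮_{≤1})^⊥ = V^{−1}B·(ℍ²)^⊥`, `𝒟₋ = E(𝓕(𝒮_{≤1}))^⊥ = I(𝒟₊) = VB^{−1}·ℍ²`
(`B` the Blaschke product over the zeros of `ζ` in `Re s > ½`, `V` the unitary multiplier
`(s−1)/s`, `I` the inversion `f(u) ↦ u^{−1}f(u^{−1})`, spectrally `s ↦ 1−s`); the scattering
operator `S = V²B^{−2}` is inner iff `B` has no zero iff RH, and "the scattering multiplier is
inner if and only if `𝒟₊ ⊥ 𝒟₋`". The Beurling–Lax / inner–outer theory of the half-plane is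
absent from Mathlib (cell boundary F8). DEVIATION (an ELEMENTARY road to the SAME typed statement,
in the spirit of the tree's discharge of Thm 2.7, `Burnol2001_thm_2_7_iff_holds`); the two inputs
taken from the printed argument are exactly

* **A. the Poisson identity `E·𝓕 = I·E`** (`Burnol2001.IsTest.mapE_fourier_eq`:
  `E(𝓕φ)(u) = u^{−1}E(φ)(u^{−1})` for `φ ∈ 𝒮_{≤1}`, `u > 0`), from Mathlib's Poisson summation
  `SchwartzMap.tsum_eq_tsum_fourier` applied to the dilate `x ↦ φ(x/u)` (the computation of the
  tree's `BurnolFourierZetaProofs`, redone here for the Müntz-modified sum `E`), with the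
  constants `𝓕φ(0) = 2∫_0^∞φ` and `∫_0^∞ 𝓕φ = φ(0)/2` (Fourier inversion at `0`) — this is
  Burnol's l.466–469 "`E(φ)(u) = u^{−1}Σ_{n≥1}𝓕(φ)(n/u) − φ(0)/2`";
* **B. the inversion `I` is an isometric involution of `L²((0,∞), du)`**
  (`Burnol2001.Causality.eLpNorm_inv_mul_comp_inv`, substitution `v = u^{−1}`).

Then:

* **C. `RH ⟹ closure`** (`causality_closure_of_riemannHypothesis`). Under RH the tree's Thm 2.6
  (`periodization_closure_of_riemannHypothesis`) and `Burnol2001.approxT_memLp` make every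
  `h ∈ L²((0,1))` an `L²`-limit of periodizations `T(ψ)`, `ψ ∈ 𝒮⁰_{≤1}`, and
  `T(ψ) = E(ψ(x)+ψ(−x))` with `ψ(x)+ψ(−x) ∈ 𝒮_{≤1}` (`Burnol2001.IsTest0.mapE_evenExt`,
  `isTest_evenExt`); so `ℍ² ⊂ cl E(𝒮_{≤1})`. Hence a `g ⊥ E(𝒮_{≤1})` vanishes a.e. on `(0,1)`
  (`Burnol2001.ae_eq_zero_Ioo_of_orthogonal`: `∫_0^1|g|² ≤ ε‖g‖` by Cauchy–Schwarz), its inversion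
  `Ig` lies in `ℍ² ⊂ cl E(𝒮_{≤1})`, and transporting back by `I` (B) with `I E(φ) = E(𝓕φ)` (A)
  puts `g` in `cl E(𝓕(𝒮_{≤1}))`. (In Burnol's notation: under RH `B = 1`, `𝒟₊ = V^{−1}(ℍ²)^⊥`,
  and `𝒟₊ ⊂ 𝒟₋^⊥ = I cl E(𝒮_{≤1})`.)
* **D. `closure ⟹ RH`** (`riemannHypothesis_of_causality`, the RH-FREE door). At a zero `s₀` of
  `ζ` with `½ < Re s₀ < 1` the explicit square-integrable function
  `g = conj((1 − 1/s₀)u^{s₀−1})` on `(0,1]`, `g = conj(−1/(s₀u))` on `(1,∞)` (the image under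
  `V* = V^{−1}` of the reproducing vector of `h ↦ ĥ(s₀)` on `ℍ²` — a "bad zero appearing where
  there should be none if the process was causal", l.160–162) is orthogonal to every `E(φ)` by the
  tree's split continuation `(s−1)∫_0^1E(φ)u^{s−1}du + ∫_0^∞φ = ζ₁(s)φ̂(s)`
  (`Burnol2001.IsTest.mellin_indicator_mapE_eq`) at `s = s₀` and `E(φ) = −(∫_0^∞φ)/u` on `(1,∞)`;
  but by (A) every `E(𝓕φ)` is the CONSTANT `−∫_0^∞φ` on `(0,1)`, and pairing `g − E(𝓕φ)` with
  `u − ½` on `(0,1)` (Cauchy–Schwarz) gives `|(s₀−1)²/(2s₀²(s₀+1))| ≤ ε` for every `ε > 0` —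
  absurd; `quasiRiemannHypothesis_one_half_iff_holds` turns "no zero in `½ < Re s < 1`" into RH.

No new definitions, no new named facts; net debt −1. With this file every RH-EQUIVALENT named
fact of `Literature/NumberTheory/LFunctions/BurnolAdelicCausality.lean` (Thms 2.1, 2.4, 2.6, 2.7,
2.8) is a theorem proved as an equivalence; the one remaining named fact of that module is the
RH-FREE Balazard–Saias–Yor formula `Burnol2001_thm_2_5` (half-plane Jensen/Carleman for `ζ`).

## References
* [Burnol2001] J.-F. Burnol, *An adelic causality problem related to abelian L-functions*,
  J. Number Theory 87 (2001) 253–269 = arXiv:math/0001013v3, Thm 2.8 (l.516–519), Thm 1.7,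
  l.464–515, §3 l.522–524.
-/

noncomputable section

open Complex Filter MeasureTheory Set
open scoped Real Topology ContDiff FourierTransform SchwartzMap

namespace Literature.NumberTheory.LFunctions

namespace Burnol2001

namespace Causality

/-! ## A. Poisson summation for the dilates of an even Schwartz function -/

/-- Dilation: `𝓕[g(·/y)](ξ) = |y| · 𝓕g(y ξ)` for `y ≠ 0`. [folklore] -/
private theorem fourier_comp_div_eq (g : ℝ → ℂ) {y : ℝ} (hy : y ≠ 0) (ξ : ℝ) :
    𝓕 (fun x : ℝ ↦ g (x / y)) ξ = ((|y| : ℝ) : ℂ) * 𝓕 g (y * ξ) := by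
  rw [Real.fourier_real_eq, Real.fourier_real_eq]
  have e : (fun v : ℝ ↦ 𝐞 (-(v * ξ)) • g (v / y)) =
      fun v : ℝ ↦ (fun u : ℝ ↦ 𝐞 (-(u * (y * ξ))) • g u) (v / y) := by
    funext v
    simp only
    congr 3
    field_simp
  rw [e, Measure.integral_comp_div (fun u : ℝ ↦ 𝐞 (-(u * (y * ξ))) • g u) y,
    Complex.real_smul]

/-- The Fourier transform of an even function is even. [folklore] -/
private theorem fourier_neg_of_even {g : ℝ → ℂ} (hg : ∀ x, g (-x) = g x) (w : ℝ) :
    𝓕 g (-w) = 𝓕 g w := by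
  rw [← Real.fourierInv_eq_fourier_neg, Real.fourierInv_eq_fourier_comp_neg]
  simp only [hg]

/-- `𝓕 g(0) = ∫ g`. [folklore] -/
private theorem fourier_apply_zero (g : ℝ → ℂ) : 𝓕 g 0 = ∫ v : ℝ, g v := by
  rw [Real.fourier_real_eq]
  simp

/-- An even integrable function has `∫_ℝ g = 2 ∫_0^∞ g`. [folklore] -/
private theorem integral_eq_two_mul_Ioi {g : ℝ → ℂ} (hg : Integrable g) (he : ∀ x, g (-x) = g x) :
    ∫ v : ℝ, g v = 2 * ∫ v in Ioi (0 : ℝ), g v := by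
  rw [← intervalIntegral.integral_Iic_add_Ioi (b := 0) hg.integrableOn hg.integrableOn]
  have : ∫ v in Iic (0 : ℝ), g v = ∫ v in Ioi (0 : ℝ), g v := by
    calc ∫ v in Iic (0 : ℝ), g v = ∫ v in Iic (0 : ℝ), g (-v) := by simp only [he]
      _ = ∫ v in Ioi (-0 : ℝ), g v := integral_comp_neg_Iic 0 g
      _ = ∫ v in Ioi (0 : ℝ), g v := by rw [neg_zero]
  rw [this, two_mul]

/-- `∫ 𝓕ψ = ψ(0)` for a Schwartz function (Fourier inversion at the origin). [folklore] -/
private theorem integral_fourier_eq (ψ : 𝓢(ℝ, ℂ)) : ∫ v : ℝ, 𝓕 (ψ : ℝ → ℂ) v = ψ 0 := by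
  have hFint : Integrable (𝓕 (ψ : ℝ → ℂ)) := by
    rw [← SchwartzMap.fourier_coe]; exact (𝓕 ψ).integrable
  have hinv := Continuous.fourierInv_fourier_eq ψ.continuous ψ.integrable hFint
  have h1 : 𝓕⁻ (𝓕 (ψ : ℝ → ℂ)) 0 = ∫ v : ℝ, 𝓕 (ψ : ℝ → ℂ) v := by
    rw [Real.fourierInv_eq_fourier_neg, neg_zero, fourier_apply_zero]
  rw [← h1, hinv]

/-- Splitting a `ℤ`-indexed sum of an even family. [folklore] -/
private theorem tsum_int_of_even {F : ℤ → ℂ} (he : ∀ n : ℤ, F (-n) = F n)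
    (hs : Summable fun n : ℕ ↦ F n) :
    ∑' n : ℤ, F n = F 0 + 2 * ∑' n : ℕ, F ((n : ℤ) + 1) := by
  have hs1 : Summable fun n : ℕ ↦ F ((n : ℤ) + 1) := by
    have := (summable_nat_add_iff 1).2 hs
    simpa [Nat.cast_succ] using this
  have hs' : Summable fun n : ℕ ↦ F (-((n : ℤ) + 1)) := by
    simpa only [he] using hs1
  rw [tsum_of_nat_of_neg_add_one hs hs', hs.tsum_eq_zero_add]
  simp only [he]
  push_cast
  ring

/-- Quadratic decay of a Schwartz function. [folklore] -/
private theorem schwartz_sq_decay (φ : 𝓢(ℝ, ℂ)) : ∃ C : ℝ, ∀ t : ℝ, t ^ 2 * ‖φ t‖ ≤ C := by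
  obtain ⟨C, -, hC⟩ := φ.decay 2 0
  refine ⟨C, fun t ↦ ?_⟩
  have h := hC t
  rwa [norm_iteratedFDeriv_zero, Real.norm_eq_abs, sq_abs] at h

/-- Quadratic decay of the Fourier transform of a Schwartz function. [folklore] -/
private theorem schwartz_fourier_sq_decay (φ : 𝓢(ℝ, ℂ)) :
    ∃ C : ℝ, ∀ t : ℝ, t ^ 2 * ‖𝓕 (φ : ℝ → ℂ) t‖ ≤ C := by
  obtain ⟨C, hC⟩ := schwartz_sq_decay (𝓕 φ)
  refine ⟨C, fun t ↦ ?_⟩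
  have h := hC t
  rwa [congrFun (SchwartzMap.fourier_coe φ) t] at h

/-- Summability of `m ↦ g(y(m+1))` from quadratic decay (`y ≠ 0`). [folklore] -/
private theorem summable_mul_succ_of_sq_decay {g : ℝ → ℂ} {C : ℝ}
    (hC : ∀ t : ℝ, t ^ 2 * ‖g t‖ ≤ C) {y : ℝ} (hy : y ≠ 0) :
    Summable fun m : ℕ ↦ g (y * ((m : ℝ) + 1)) := by
  have hs : Summable fun m : ℕ ↦ C / y ^ 2 * (1 / ((m : ℝ) + 1) ^ 2) := by
    have := (summable_nat_add_iff 1).2 (Real.summable_one_div_nat_pow.2 one_lt_two)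
    refine (Summable.mul_left (C / y ^ 2) ?_)
    simpa [Nat.cast_succ] using this
  refine Summable.of_norm_bounded hs fun m ↦ ?_
  have hm : y * ((m : ℝ) + 1) ≠ 0 := mul_ne_zero hy (by positivity)
  have h1 := hC (y * ((m : ℝ) + 1))
  have hpos : 0 < (y * ((m : ℝ) + 1)) ^ 2 := by positivity
  rw [show C / y ^ 2 * (1 / ((m : ℝ) + 1) ^ 2) = C / (y * ((m : ℝ) + 1)) ^ 2 by field_simp]
  rw [le_div_iff₀ hpos, mul_comm]
  exact h1

/-- **Poisson summation for the dilate of an even Schwartz function** (`u ≠ 0`):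
`Σ_{n ≥ 1} φ(nu) = −φ(0)/2 + 𝓕φ(0)/(2|u|) + |u|⁻¹ Σ_{m ≥ 1} 𝓕φ(m/u)` — Burnol's
"`T(φ)(u) = |u|^{-1} Σ_{n∈ℤ} ψ(n/u)` where `ψ` is the Fourier transform of `φ`" and
"`E(φ)(u) = u^{-1}Σ_{n≥1}𝓕(φ)(n/u) − φ(0)/2`", from Mathlib's `SchwartzMap.tsum_eq_tsum_fourier`.
[cite: Burnol2001, §2 (before Thm 2.6 and before Thm 2.7), arXiv v3 TeX l.430–432, l.466–469] -/
theorem tsum_dilate_eq (φ : 𝓢(ℝ, ℂ)) (he : ∀ x : ℝ, φ (-x) = φ x) {u : ℝ} (hu : u ≠ 0) :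
    ∑' n : ℕ, φ (((n : ℝ) + 1) * u) =
      -(φ 0) / 2 + ((|u|⁻¹ : ℝ) : ℂ) * 𝓕 (φ : ℝ → ℂ) 0 / 2 +
        ((|u|⁻¹ : ℝ) : ℂ) * ∑' m : ℕ, 𝓕 (φ : ℝ → ℂ) (u⁻¹ * ((m : ℝ) + 1)) := by
  set ψ : 𝓢(ℝ, ℂ) := SchwartzMap.compCLMOfContinuousLinearEquiv ℂ
    (ContinuousLinearEquiv.unitsEquivAut ℝ (Units.mk0 u hu)) φ with hψ
  have hψapply : ∀ x : ℝ, ψ x = φ (x * u) := fun x ↦ rfl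
  have hP := SchwartzMap.tsum_eq_tsum_fourier ψ 0
  simp only [zero_add, QuotientAddGroup.mk_zero, fourier_eval_zero, mul_one] at hP
  -- Fourier transform of the dilate
  have hFψ : ∀ m : ℤ, (𝓕 ψ) m = ((|u⁻¹| : ℝ) : ℂ) * 𝓕 (φ : ℝ → ℂ) (u⁻¹ * m) := by
    intro m
    rw [congrFun (SchwartzMap.fourier_coe ψ) m]
    have e : (ψ : ℝ → ℂ) = fun x : ℝ ↦ φ (x / u⁻¹) := by
      funext x; rw [hψapply, div_inv_eq_mul]
    rw [e]
    exact fourier_comp_div_eq (φ : ℝ → ℂ) (inv_ne_zero hu) m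
  simp only [hψapply, hFψ] at hP
  -- split both sides
  obtain ⟨C₁, hC₁⟩ := schwartz_sq_decay φ
  obtain ⟨C₂, hC₂⟩ := schwartz_fourier_sq_decay φ
  have hLeven : ∀ n : ℤ, φ (((-n : ℤ) : ℝ) * u) = φ ((n : ℝ) * u) := by
    intro n; rw [Int.cast_neg, neg_mul, he]
  have hLsum : Summable fun n : ℕ ↦ φ ((n : ℝ) * u) := by
    have h1 : Summable fun n : ℕ ↦ φ (u * ((n : ℝ) + 1)) := summable_mul_succ_of_sq_decay hC₁ hu
    have h2 := (summable_nat_add_iff (f := fun n : ℕ ↦ φ ((n : ℝ) * u)) 1).1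
    apply h2
    refine h1.congr fun n ↦ ?_
    push_cast; ring_nf
  have hL := tsum_int_of_even (F := fun n : ℤ ↦ φ ((n : ℝ) * u)) hLeven (by simpa using hLsum)
  have hFeven : ∀ w : ℝ, 𝓕 (φ : ℝ → ℂ) (-w) = 𝓕 (φ : ℝ → ℂ) w := fourier_neg_of_even he
  have hReven : ∀ m : ℤ, ((|u⁻¹| : ℝ) : ℂ) * 𝓕 (φ : ℝ → ℂ) (u⁻¹ * ((-m : ℤ) : ℝ)) =
      ((|u⁻¹| : ℝ) : ℂ) * 𝓕 (φ : ℝ → ℂ) (u⁻¹ * (m : ℝ)) := by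
    intro m; rw [Int.cast_neg, mul_neg, hFeven]
  have hRsum : Summable fun m : ℕ ↦ ((|u⁻¹| : ℝ) : ℂ) * 𝓕 (φ : ℝ → ℂ) (u⁻¹ * (m : ℝ)) := by
    have h1 : Summable fun m : ℕ ↦ ((|u⁻¹| : ℝ) : ℂ) * 𝓕 (φ : ℝ → ℂ) (u⁻¹ * ((m : ℝ) + 1)) :=
      (summable_mul_succ_of_sq_decay hC₂ (inv_ne_zero hu)).mul_left _
    have h2 := (summable_nat_add_iff
      (f := fun m : ℕ ↦ ((|u⁻¹| : ℝ) : ℂ) * 𝓕 (φ : ℝ → ℂ) (u⁻¹ * (m : ℝ))) 1).1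
    apply h2
    simpa [Nat.cast_succ] using h1
  have hR := tsum_int_of_even
    (F := fun m : ℤ ↦ ((|u⁻¹| : ℝ) : ℂ) * 𝓕 (φ : ℝ → ℂ) (u⁻¹ * (m : ℝ))) hReven
    (by simpa using hRsum)
  simp only [Int.cast_zero, zero_mul, mul_zero] at hL hR
  rw [hL, hR] at hP
  have h3 : (∑' n : ℕ, φ ((((n : ℤ) + 1 : ℤ) : ℝ) * u)) = ∑' n : ℕ, φ (((n : ℝ) + 1) * u) := by
    congr 1; funext n; push_cast; rfl
  have h4 : (∑' m : ℕ, ((|u⁻¹| : ℝ) : ℂ) * 𝓕 (φ : ℝ → ℂ) (u⁻¹ * ((((m : ℤ) + 1 : ℤ) : ℝ)))) =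
      ((|u⁻¹| : ℝ) : ℂ) * ∑' m : ℕ, 𝓕 (φ : ℝ → ℂ) (u⁻¹ * ((m : ℝ) + 1)) := by
    rw [← tsum_mul_left]; congr 1; funext m; push_cast; rfl
  rw [h3, h4, abs_inv] at hP
  linear_combination hP / 2

end Causality

namespace IsTest

variable {φ : ℝ → ℂ}

/-- A test function `φ ∈ 𝒮_{≤1}` has compact support. [cite: Burnol2001, §2 (before Thm 2.7)] -/
theorem hasCompactSupport (hφ : IsTest φ) : HasCompactSupport φ :=
  HasCompactSupport.intro isCompact_Icc fun x hx ↦ by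
    by_contra h
    exact hx (hφ.2.2 (Function.mem_support.2 h))

/-- A test function vanishes at every `x < -1`. [cite: Burnol2001, §2 (before Thm 2.7)] -/
theorem eq_zero_of_lt_neg_one (hφ : IsTest φ) {x : ℝ} (hx : x < -1) : φ x = 0 := by
  rw [← hφ.2.1 x]
  exact hφ.eq_zero_of_one_lt (by linarith)

/-- A test function is integrable. [cite: Burnol2001, §2 (before Thm 2.7)] -/
theorem integrable (hφ : IsTest φ) : Integrable φ :=
  hφ.continuous.integrable_of_hasCompactSupport hφ.hasCompactSupport

/-- `𝓕φ(0) = 2 ∫_0^∞ φ` for `φ ∈ 𝒮_{≤1}` (even). [cite: Burnol2001, §2 (before Thm 2.7)] -/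
theorem fourier_apply_zero (hφ : IsTest φ) : 𝓕 φ 0 = 2 * ∫ x in Ioi (0 : ℝ), φ x := by
  rw [Causality.fourier_apply_zero, Causality.integral_eq_two_mul_Ioi hφ.integrable hφ.2.1]

/-- `𝓕φ` is even and integrable with `∫_0^∞ 𝓕φ = φ(0)/2` for `φ ∈ 𝒮_{≤1}`.
[cite: Burnol2001, §2 (before Thm 2.7), TeX l.466–469] -/
theorem integral_Ioi_fourier (hφ : IsTest φ) : ∫ x in Ioi (0 : ℝ), 𝓕 φ x = φ 0 / 2 := by
  set Φ : 𝓢(ℝ, ℂ) := hφ.hasCompactSupport.toSchwartzMap hφ.1 with hΦ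
  have hcoe : (Φ : ℝ → ℂ) = φ := rfl
  have hFint : Integrable (𝓕 φ) := by
    rw [← hcoe, ← SchwartzMap.fourier_coe]; exact (𝓕 Φ).integrable
  have h2 := Causality.integral_eq_two_mul_Ioi hFint (Causality.fourier_neg_of_even hφ.2.1)
  have h3 : ∫ v : ℝ, 𝓕 φ v = φ 0 := by
    rw [← hcoe]; exact Causality.integral_fourier_eq Φ
  rw [h3] at h2
  linear_combination (-(1 : ℂ) / 2) * h2

/-- **The Poisson summation identity for `E`** (Burnol, TeX l.466–469: "The Poisson summation
formula gives `E(φ)(u) = u^{-1} Σ_{n≥1} 𝓕(φ)(n/u) − φ(0)/2`"), in the form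
`E(𝓕φ)(u) = u^{-1} E(φ)(u^{-1})` (`u > 0`): the map `E` intertwines the Fourier transform with
the inversion `I : f(u) ↦ u^{-1} f(u^{-1})` (the `ζ`-case of "`E·𝓕 = I·E`", TeX l.522–524).
[cite: Burnol2001, §2 (before Thm 2.7), TeX l.466–469; §3 l.522–524] -/
theorem mapE_fourier_eq (hφ : IsTest φ) {u : ℝ} (hu : 0 < u) :
    mapE (𝓕 φ) u = ((u : ℂ)⁻¹) * mapE φ u⁻¹ := by
  set Φ : 𝓢(ℝ, ℂ) := hφ.hasCompactSupport.toSchwartzMap hφ.1 with hΦ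
  have hcoe : (Φ : ℝ → ℂ) = φ := rfl
  have hu0 : u ≠ 0 := hu.ne'
  have hui : u⁻¹ ≠ 0 := inv_ne_zero hu0
  -- Poisson summation for the dilate `x ↦ φ(x/u)`, i.e. at the point `u⁻¹`
  have hP := Causality.tsum_dilate_eq Φ hφ.2.1 hui
  simp only [abs_inv, inv_inv, abs_of_pos hu, hcoe] at hP
  -- the constants
  have hc0 : 𝓕 φ 0 = 2 * ∫ x in Ioi (0 : ℝ), φ x := hφ.fourier_apply_zero
  have hc1 : ∫ x in Ioi (0 : ℝ), 𝓕 φ x = φ 0 / 2 := hφ.integral_Ioi_fourier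
  have huc : (u : ℂ) ≠ 0 := by exact_mod_cast hu0
  simp only [mapE]
  have e1 : (∑' n : ℕ, 𝓕 φ (((n + 1 : ℕ) : ℝ) * u)) = ∑' m : ℕ, 𝓕 φ (u * ((m : ℝ) + 1)) := by
    congr 1; funext n; push_cast; ring_nf
  have e2 : (∑' n : ℕ, φ (((n + 1 : ℕ) : ℝ) * u⁻¹)) = ∑' n : ℕ, φ (((n : ℝ) + 1) * u⁻¹) := by
    congr 1; funext n; push_cast; ring_nf
  rw [e1, e2, hP, hc1, hc0]
  push_cast
  field_simp
  ring

end IsTest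


namespace Causality

/-! ## B. The inversion `I : f(u) ↦ u⁻¹ f(u⁻¹)` is an isometry of `L²((0,∞), du)` -/

/-- `‖I f‖_{L²((0,∞))} = ‖f‖_{L²((0,∞))}` for the inversion `(I f)(u) = u⁻¹ f(u⁻¹)` (substitution
`v = u⁻¹`, `dv = u⁻² du`) — Burnol: "`I` is an isometry which interchanges dilations and
contractions" (the `ζ`-case, where `I` is `f(u) ↦ u^{-1}f(u^{-1})` on `L²((0,∞), du)`).
[cite: Burnol2001, §1 (Note after Lemma 1.5), arXiv v3 TeX l.262–264; §2 l.503–505] -/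
theorem eLpNorm_inv_mul_comp_inv (F : ℝ → ℂ) :
    eLpNorm (fun u : ℝ ↦ ((u : ℂ)⁻¹) * F u⁻¹) 2 (volume.restrict (Ioi (0 : ℝ))) =
      eLpNorm F 2 (volume.restrict (Ioi (0 : ℝ))) := by
  have himg : (fun x : ℝ ↦ x⁻¹) '' Ioi (0 : ℝ) = Ioi 0 := by
    ext y
    constructor
    · rintro ⟨x, hx, rfl⟩
      exact mem_Ioi.2 (inv_pos.2 (mem_Ioi.1 hx))
    · intro hy
      exact ⟨y⁻¹, mem_Ioi.2 (inv_pos.2 (mem_Ioi.1 hy)), inv_inv y⟩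
  have hderiv : ∀ x ∈ Ioi (0 : ℝ),
      HasDerivWithinAt (fun x : ℝ ↦ x⁻¹) (-(x ^ 2)⁻¹) (Ioi 0) x :=
    fun x hx ↦ (hasDerivAt_inv (ne_of_gt hx)).hasDerivWithinAt
  have hinj : InjOn (fun x : ℝ ↦ x⁻¹) (Ioi 0) := inv_injective.injOn
  have key := lintegral_image_eq_lintegral_abs_deriv_mul measurableSet_Ioi hderiv hinj
    (fun v ↦ ‖F v‖ₑ ^ (2 : ℝ))
  rw [himg] at key
  rw [eLpNorm_eq_lintegral_rpow_enorm_toReal two_ne_zero ENNReal.ofNat_ne_top,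
    eLpNorm_eq_lintegral_rpow_enorm_toReal two_ne_zero ENNReal.ofNat_ne_top, ENNReal.toReal_ofNat,
    key]
  congr 1
  refine setLIntegral_congr_fun measurableSet_Ioi fun x (hx : 0 < x) ↦ ?_
  have hx2 : |-(x ^ 2)⁻¹| = (x⁻¹) ^ 2 := by
    rw [abs_neg, abs_of_pos (by positivity), inv_pow]
  rw [hx2, enorm_mul, ENNReal.mul_rpow_of_nonneg _ _ (by norm_num : (0 : ℝ) ≤ 2)]
  congr 1
  rw [← ofReal_norm, norm_inv, Complex.norm_real, Real.norm_eq_abs, abs_of_pos hx,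
    ENNReal.ofReal_rpow_of_nonneg (by positivity) (by norm_num)]
  norm_num

/-- The inversion `I f(u) = u⁻¹ f(u⁻¹)` preserves square-integrability on `(0,∞)` (measurable
representative; "`I` is an isometry"). [cite: Burnol2001, §1 (Note after Lemma 1.5), arXiv v3 TeX l.262–264] -/
theorem memLp_inv_mul_comp_inv {F : ℝ → ℂ} (hFm : Measurable F)
    (hF : MemLp F 2 (volume.restrict (Ioi (0 : ℝ)))) :
    MemLp (fun u : ℝ ↦ ((u : ℂ)⁻¹) * F u⁻¹) 2 (volume.restrict (Ioi (0 : ℝ))) := by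
  refine ⟨((Complex.measurable_ofReal.inv).mul (hFm.comp measurable_inv)).aestronglyMeasurable, ?_⟩
  rw [eLpNorm_inv_mul_comp_inv]
  exact hF.eLpNorm_lt_top

end Causality

namespace IsTest0

variable {ψ : ℝ → ℂ}

/-- The even extension `x ↦ ψ(x) + ψ(−x)` of `ψ ∈ 𝒮⁰_{≤1}` lies in `𝒮_{≤1}` (all derivatives
of `ψ` vanish at `0`, where `ψ` is flat). [cite: Burnol2001, §2 (before Thm 2.7)] -/
theorem isTest_evenExt (hψ : IsTest0 ψ) : IsTest (fun x : ℝ ↦ ψ x + ψ (-x)) := by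
  refine ⟨hψ.1.add (hψ.1.comp contDiff_neg), fun x ↦ ?_, ?_⟩
  · simp only [neg_neg]
    exact add_comm _ _
  · intro x hx
    rw [Function.mem_support] at hx
    by_contra hx'
    apply hx
    rcases lt_or_ge 1 x with h1 | h1
    · rw [hψ.eq_zero_of_one_lt h1, hψ.eq_zero_of_neg (by linarith), add_zero]
    · have h2 : x < -1 := by
        by_contra h2
        exact hx' ⟨not_lt.1 h2, h1⟩
      rw [hψ.eq_zero_of_neg (by linarith), hψ.eq_zero_of_one_lt (by linarith), add_zero]

/-- `E(ψ(x) + ψ(−x)) = T(ψ)` on `(0,∞)`: the reflected terms vanish and `∫_0^∞ ψ = 0` kills the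
polar part `c/u`. So `T(𝒮⁰_{≤1}) ⊂ E(𝒮_{≤1})`. [cite: Burnol2001, §2 (before Thm 2.7)] -/
theorem mapE_evenExt (hψ : IsTest0 ψ) {u : ℝ} (hu : 0 < u) :
    mapE (fun x : ℝ ↦ ψ x + ψ (-x)) u = mapT ψ u := by
  have h1 : ∀ n : ℕ, ψ ((n + 1 : ℕ) * u) + ψ (-((n + 1 : ℕ) * u)) = ψ ((n + 1 : ℕ) * u) := by
    intro n
    have hneg : -((n + 1 : ℕ) * u : ℝ) < 0 := by
      have : (0 : ℝ) < (n + 1 : ℕ) * u := by positivity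
      linarith
    rw [hψ.eq_zero_of_neg hneg, add_zero]
  have h2 : ∫ x in Ioi (0 : ℝ), (ψ x + ψ (-x)) = 0 := by
    rw [setIntegral_congr_fun measurableSet_Ioi (fun x (hx : (0 : ℝ) < x) ↦ by
      rw [hψ.eq_zero_of_neg (neg_lt_zero.2 hx), add_zero]), hψ.integral_Ioi_eq_zero]
  simp only [mapE, mapT, h1, h2, zero_div, sub_zero]

end IsTest0

end Burnol2001

open Burnol2001

/-! ## C. `RH ⟹ E(𝒮_{≤1})^⊥ ⊂ cl E(𝓕(𝒮_{≤1}))` -/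

/-- Under RH, a square-integrable `g` on `(0,∞)` orthogonal to all `E(φ)`, `φ ∈ 𝒮_{≤1}`,
vanishes a.e. on `(0,1)`: it is orthogonal to every `T(ψ) = E(ψ(x)+ψ(−x))`, `ψ ∈ 𝒮⁰_{≤1}`, and
these are dense in `L²((0,1))` under RH (Thm 2.6 + `Burnol2001.approxT_memLp`).
[cite: Burnol2001, Thm 2.8 (arXiv v3 l.516–519); Thm 2.6] -/
theorem Burnol2001.ae_eq_zero_Ioo_of_orthogonal (hRH : RiemannHypothesis) {g : ℝ → ℂ}
    (hg : MemLp g 2 (volume.restrict (Ioi (0 : ℝ))))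
    (horth : ∀ φ : ℝ → ℂ, IsTest φ →
      ∫ u in Ioi (0 : ℝ), (starRingEnd ℂ) (mapE φ u) * g u = 0) :
    ∀ᵐ u ∂(volume.restrict (Ioo (0 : ℝ) 1)), g u = 0 := by
  set μ1 : Measure ℝ := volume.restrict (Ioo (0 : ℝ) 1) with hμ1
  have hg1 : MemLp g 2 μ1 := hg.mono_measure (Measure.restrict_mono_set _ Ioo_subset_Ioi_self)
  have h26 := periodization_closure_of_riemannHypothesis hRH
  -- orthogonality to every periodization, on `(0,1)`
  have horth' : ∀ ψ : ℝ → ℂ, IsTest0 ψ →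
      ∫ u in Ioo (0 : ℝ) 1, (starRingEnd ℂ) (g u) * mapT ψ u = 0 := by
    intro ψ hψ
    have h0 := horth _ hψ.isTest_evenExt
    rw [setIntegral_congr_fun measurableSet_Ioi
      (fun u (hu : (0 : ℝ) < u) ↦ by rw [hψ.mapE_evenExt hu])] at h0
    rw [setIntegral_eq_of_subset_of_forall_sdiff_eq_zero measurableSet_Ioi Ioc_subset_Ioi_self
      (fun x hx ↦ by
        have hx1 : 1 < x := by
          rcases hx with ⟨hx0, hx1⟩
          by_contra h
          exact hx1 ⟨hx0, not_lt.1 h⟩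
        rw [hψ.mapT_eq_zero_of_one_lt hx1, map_zero, zero_mul]),
      ← setIntegral_congr_set Ioo_ae_eq_Ioc] at h0
    have : ∫ u in Ioo (0 : ℝ) 1, (starRingEnd ℂ) (g u) * mapT ψ u =
        (starRingEnd ℂ) (∫ u in Ioo (0 : ℝ) 1, (starRingEnd ℂ) (mapT ψ u) * g u) := by
      rw [← integral_conj]
      refine integral_congr_ae (Eventually.of_forall fun u ↦ ?_)
      simp only [map_mul, RingHomCompTriple.comp_apply, RingHom.id_apply, mul_comm]
    rw [this, h0, map_zero]
  -- the conjugate `ḡ` and the `L²` norm `M` of `g` on `(0,1)`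
  set G : ℝ → ℂ := fun u ↦ (starRingEnd ℂ) (g u) with hG
  have hGm : AEStronglyMeasurable G μ1 := Complex.continuous_conj.comp_aestronglyMeasurable hg1.1
  have hGn : eLpNorm G 2 μ1 = eLpNorm g 2 μ1 :=
    eLpNorm_congr_norm_ae (Eventually.of_forall fun u ↦ Complex.norm_conj _)
  have hG2 : MemLp G 2 μ1 := ⟨hGm, by rw [hGn]; exact hg1.eLpNorm_lt_top⟩
  set M : ℝ := (eLpNorm g 2 μ1).toReal with hM
  have hM0 : 0 ≤ M := ENNReal.toReal_nonneg
  -- `P = ∫_0^1 ḡ g = ∫_0^1 |g|²`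
  have hsq : ∫ u in Ioo (0 : ℝ) 1, G u * g u = ((∫ u in Ioo (0 : ℝ) 1, ‖g u‖ ^ 2 : ℝ) : ℂ) := by
    rw [← integral_complex_ofReal]
    refine integral_congr_ae (Eventually.of_forall fun u ↦ ?_)
    simp only [hG, Complex.conj_mul', Complex.ofReal_pow]
  have hint : Integrable (fun u ↦ ‖g u‖ ^ 2) μ1 := (memLp_two_iff_integrable_sq_norm hg1.1).1 hg1
  have hI0 : 0 ≤ ∫ u in Ioo (0 : ℝ) 1, ‖g u‖ ^ 2 := integral_nonneg fun u ↦ sq_nonneg _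
  -- Key estimate: for every `ε > 0`, `∫_0^1 |g|² ≤ ε M`.
  have key : ∀ ε : ℝ, 0 < ε → (∫ u in Ioo (0 : ℝ) 1, ‖g u‖ ^ 2) ≤ ε * M := by
    intro ε hε
    obtain ⟨ψ, hψ, e⟩ := approxT_memLp h26 hg1 ε hε
    set D : ℝ → ℂ := fun u ↦ g u - mapT ψ u with hD
    have hDm : AEStronglyMeasurable D μ1 := hg1.1.sub hψ.aestronglyMeasurable_mapT_Ioo
    have hD2 : MemLp D 2 μ1 := ⟨hDm, e.trans ENNReal.ofReal_lt_top⟩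
    have hT2 : MemLp (mapT ψ) 2 μ1 := by
      refine (hg1.sub hD2).ae_eq (Eventually.of_forall fun u ↦ ?_)
      simp only [hD, Pi.sub_apply, sub_sub_cancel]
    -- integrability of the three products
    have hi1 : Integrable (fun u ↦ G u * g u) μ1 := memLp_one_iff_integrable.1 (hg1.mul' hG2)
    have hi2 : Integrable (fun u ↦ G u * mapT ψ u) μ1 :=
      memLp_one_iff_integrable.1 (hT2.mul' hG2)
    -- `∫ ḡ g = ∫ ḡ D`
    have hPD : ∫ u in Ioo (0 : ℝ) 1, G u * g u = ∫ u in Ioo (0 : ℝ) 1, (D • G) u := by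
      have : (D • G) = fun u ↦ G u * g u - G u * mapT ψ u := by
        funext u; simp only [Pi.smul_apply', smul_eq_mul, hD]; ring
      rw [this, integral_sub hi1 hi2, horth' ψ hψ, sub_zero]
    -- Hölder
    have hH : eLpNorm (D • G) 1 μ1 ≤ ENNReal.ofReal ε * eLpNorm g 2 μ1 := by
      calc eLpNorm (D • G) 1 μ1 ≤ eLpNorm D 2 μ1 * eLpNorm G 2 μ1 :=
            eLpNorm_smul_le_mul_eLpNorm hGm hDm
        _ ≤ ENNReal.ofReal ε * eLpNorm g 2 μ1 := by rw [hGn]; gcongr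
    have hfin : ENNReal.ofReal ε * eLpNorm g 2 μ1 ≠ ⊤ :=
      ENNReal.mul_ne_top ENNReal.ofReal_ne_top hg1.eLpNorm_lt_top.ne
    have hle : ‖∫ u in Ioo (0 : ℝ) 1, (D • G) u‖ ≤ ε * M := by
      calc ‖∫ u in Ioo (0 : ℝ) 1, (D • G) u‖
          ≤ (∫⁻ u in Ioo (0 : ℝ) 1, ENNReal.ofReal ‖(D • G) u‖).toReal :=
            norm_integral_le_lintegral_norm _
        _ = (eLpNorm (D • G) 1 μ1).toReal := by
            rw [eLpNorm_one_eq_lintegral_enorm]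
            simp_rw [ofReal_norm]
            rfl
        _ ≤ (ENNReal.ofReal ε * eLpNorm g 2 μ1).toReal := ENNReal.toReal_mono hfin hH
        _ = ε * M := by rw [ENNReal.toReal_mul, ENNReal.toReal_ofReal hε.le]
    have hnorm : ‖∫ u in Ioo (0 : ℝ) 1, G u * g u‖ = ∫ u in Ioo (0 : ℝ) 1, ‖g u‖ ^ 2 := by
      rw [hsq, Complex.norm_real, Real.norm_eq_abs, abs_of_nonneg hI0]
    rw [← hnorm, hPD]
    exact hle
  -- hence `∫_0^1 |g|² = 0`
  have hI : ∫ u in Ioo (0 : ℝ) 1, ‖g u‖ ^ 2 = 0 := by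
    by_contra hne
    have hpos : 0 < ∫ u in Ioo (0 : ℝ) 1, ‖g u‖ ^ 2 := lt_of_le_of_ne hI0 (Ne.symm hne)
    have := key ((∫ u in Ioo (0 : ℝ) 1, ‖g u‖ ^ 2) / (2 * (M + 1))) (by positivity)
    have hlt : (∫ u in Ioo (0 : ℝ) 1, ‖g u‖ ^ 2) / (2 * (M + 1)) * M <
        ∫ u in Ioo (0 : ℝ) 1, ‖g u‖ ^ 2 := by
      rw [div_mul_eq_mul_div, div_lt_iff₀ (by positivity)]
      nlinarith
    linarith
  have hae := (integral_eq_zero_iff_of_nonneg_ae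
    (Eventually.of_forall fun u ↦ sq_nonneg ‖g u‖) hint).1 hI
  filter_upwards [hae] with u hu
  simpa using hu

/-- **Burnol 2001, Thm 2.8, the half `RH ⟹ E(𝒮_{≤1})^⊥ ⊂ cl E(𝓕(𝒮_{≤1}))`.**
ELEMENTARY ROAD (the printed proof reads the scattering operator `S = V²B^{−2}` off the
Beurling–Lax description `𝒟₊ = V^{−1}B·(ℍ²)^⊥`, absent from Mathlib; DEVIATION, same statement):
under RH every `h ∈ ℍ²` is an `L²((0,∞))`-limit of periodizations `T(ψ) = E(ψ(x)+ψ(−x))`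
(Thm 2.6 + `Burnol2001.approxT_memLp`), so `ℍ² ⊂ cl E(𝒮_{≤1})`; a `g ⊥ E(𝒮_{≤1})` therefore
vanishes a.e. on `(0,1)` (`Burnol2001.ae_eq_zero_Ioo_of_orthogonal`), its inversion
`I g(u) = u⁻¹g(u⁻¹)` lies in `ℍ² ⊂ cl E(𝒮_{≤1})`, and transporting back by the isometric
involution `I` with the Poisson identity `I E(φ) = E(𝓕φ)` (`Burnol2001.IsTest.mapE_fourier_eq`,
Burnol's "`E·𝓕 = I·E`", whence `𝒟₋ = I(𝒟₊)`) puts `g` in `cl E(𝓕(𝒮_{≤1}))`.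
[cite: Burnol2001, Thm 2.8 (arXiv v3 l.500–519)] -/
theorem causality_closure_of_riemannHypothesis (hRH : RiemannHypothesis) :
    ∀ g : ℝ → ℂ, MemLp g 2 (volume.restrict (Ioi (0 : ℝ))) →
      (∀ φ : ℝ → ℂ, IsTest φ → ∫ u in Ioi (0 : ℝ), (starRingEnd ℂ) (mapE φ u) * g u = 0) →
      ∀ ε : ℝ, 0 < ε → ∃ φ : ℝ → ℂ, IsTest φ ∧
        eLpNorm (fun u : ℝ ↦ g u - mapE (𝓕 φ) u) 2 (volume.restrict (Ioi (0 : ℝ))) <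
          ENNReal.ofReal ε := by
  intro g hg horth ε hε
  have h26 := periodization_closure_of_riemannHypothesis hRH
  -- Step 1: `g = 0` a.e. on `(0,1)`
  have hzero := Burnol2001.ae_eq_zero_Ioo_of_orthogonal hRH hg horth
  -- Step 2: a measurable representative `g'` of `g` vanishing on `(0,1]`
  set g₁ : ℝ → ℂ := hg.1.mk g with hg₁
  have hg₁m : Measurable g₁ := hg.1.stronglyMeasurable_mk.measurable
  have hgg₁ : g =ᵐ[(volume.restrict (Ioi (0 : ℝ)))] g₁ := hg.1.ae_eq_mk
  set g' : ℝ → ℂ := (Ioi (1 : ℝ)).indicator g₁ with hg'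
  have hg'm : Measurable g' := hg₁m.indicator measurableSet_Ioi
  have hgg' : g =ᵐ[(volume.restrict (Ioi (0 : ℝ)))] g' := by
    have h1 : ∀ᵐ u ∂(volume.restrict (Ioi (0 : ℝ))), u ∈ Ioo (0 : ℝ) 1 → g u = 0 :=
      ae_restrict_of_ae ((ae_restrict_iff' measurableSet_Ioo).1 hzero)
    have h2 : ∀ᵐ u ∂(volume.restrict (Ioi (0 : ℝ))), u ∉ ({1} : Set ℝ) :=
      ae_restrict_of_ae (measure_eq_zero_iff_ae_notMem.1 (measure_singleton (1 : ℝ)))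
    filter_upwards [hgg₁, h1, h2, ae_restrict_mem measurableSet_Ioi] with u hu1 hu2 hu3 hu4
    have hu0 : (0 : ℝ) < u := hu4
    have hne : u ≠ 1 := fun h ↦ hu3 (mem_singleton_iff.2 h)
    rcases lt_or_gt_of_ne hne with hlt | hgt
    · rw [hu2 ⟨hu0, hlt⟩, hg', indicator_of_notMem (fun h : u ∈ Ioi (1 : ℝ) ↦
        absurd (mem_Ioi.1 h) (not_lt.2 hlt.le))]
    · rw [hg', indicator_of_mem (show u ∈ Ioi (1 : ℝ) from hgt), ← hu1]
  -- Step 3: `G := I g'` is square-integrable and vanishes on `[1, ∞)`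
  set G : ℝ → ℂ := fun u ↦ ((u : ℂ)⁻¹) * g' u⁻¹ with hGdef
  have hg'2 : MemLp g' 2 (volume.restrict (Ioi (0 : ℝ))) := hg.ae_eq hgg'
  have hG2 : MemLp G 2 (volume.restrict (Ioi (0 : ℝ))) := Causality.memLp_inv_mul_comp_inv hg'm hg'2
  have hG0 : ∀ u : ℝ, 1 ≤ u → G u = 0 := by
    intro u hu
    have : u⁻¹ ∉ Ioi (1 : ℝ) := fun h ↦
      absurd (mem_Ioi.1 h) (not_lt.2 (inv_le_one_of_one_le₀ hu))
    simp only [hGdef, hg', indicator_of_notMem this, mul_zero]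
  -- Step 4: approximate `G` on `(0,1)` by a periodization `T(ψ) = E(ψ(x)+ψ(−x))`
  have hG01 : MemLp G 2 (volume.restrict (Ioo (0 : ℝ) 1)) :=
    hG2.mono_measure (Measure.restrict_mono_set _ Ioo_subset_Ioi_self)
  obtain ⟨ψ, hψ, e⟩ := approxT_memLp h26 hG01 ε hε
  have hφ := hψ.isTest_evenExt
  refine ⟨fun x : ℝ ↦ ψ x + ψ (-x), hφ, ?_⟩
  have hGE : eLpNorm (fun u ↦ G u - mapE (fun x : ℝ ↦ ψ x + ψ (-x)) u) 2 (volume.restrict (Ioi (0 : ℝ))) <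
      ENNReal.ofReal ε := by
    have hae : (fun u : ℝ ↦ G u - mapE (fun x : ℝ ↦ ψ x + ψ (-x)) u) =ᵐ[(volume.restrict (Ioi (0 : ℝ)))]
        (Ioc (0 : ℝ) 1).indicator (fun u ↦ G u - mapT ψ u) := by
      filter_upwards [ae_restrict_mem measurableSet_Ioi] with u hu
      rw [hψ.mapE_evenExt hu]
      by_cases hu1 : u ≤ 1
      · rw [indicator_of_mem (show u ∈ Ioc (0 : ℝ) 1 from ⟨hu, hu1⟩)]
      · have hu1' : 1 < u := not_le.1 hu1
        rw [indicator_of_notMem (fun h : u ∈ Ioc (0 : ℝ) 1 ↦ hu1 h.2), hG0 u hu1'.le,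
          hψ.mapT_eq_zero_of_one_lt hu1', sub_zero]
    rw [eLpNorm_congr_ae hae, eLpNorm_indicator_eq_eLpNorm_restrict measurableSet_Ioc,
      Measure.restrict_restrict measurableSet_Ioc, inter_eq_left.2 Ioc_subset_Ioi_self,
      ← Measure.restrict_congr_set Ioo_ae_eq_Ioc]
    exact e
  -- Step 5: transport by `I` and the Poisson identity `E(𝓕φ) = I E(φ)`
  have hae2 : (fun u : ℝ ↦ g u - mapE (𝓕 fun x : ℝ ↦ ψ x + ψ (-x)) u) =ᵐ[(volume.restrict (Ioi (0 : ℝ)))]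
      fun u ↦ ((u : ℂ)⁻¹) * (fun v ↦ G v - mapE (fun x : ℝ ↦ ψ x + ψ (-x)) v) u⁻¹ := by
    filter_upwards [hgg', ae_restrict_mem measurableSet_Ioi] with u hu1 hu
    have hu0 : (0 : ℝ) < u := hu
    have huc : (u : ℂ) ≠ 0 := by exact_mod_cast hu0.ne'
    rw [hu1, hφ.mapE_fourier_eq hu0]
    simp only [hGdef, inv_inv, Complex.ofReal_inv]
    field_simp
  rw [eLpNorm_congr_ae hae2]
  exact (Causality.eLpNorm_inv_mul_comp_inv
    (fun v ↦ G v - mapE (fun x : ℝ ↦ ψ x + ψ (-x)) v)).trans_lt hGE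

/-! ## D. The door: `E(𝒮_{≤1})^⊥ ⊂ cl E(𝓕(𝒮_{≤1}))` ⟹ RH -/

/-- **Burnol 2001, Thm 2.8, the RH-FREE half**: if every square-integrable `g` on `(0,∞)`
orthogonal to `E(𝒮_{≤1})` is an `L²((0,∞))`-limit of functions `E(𝓕φ)`, `φ ∈ 𝒮_{≤1}` — the
left-hand side of `Literature.NumberTheory.LFunctions.Burnol2001_thm_2_8` verbatim — then RH
holds. ELEMENTARY ROAD (Burnol: "the scattering multiplier `((s−1)/s)²B(s)^{−2}` is inner iff
`B` has no zero", via Lax–Phillips; DEVIATION, same statement): at a zero `s₀` of `ζ` with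
`½ < Re s₀ < 1` the explicit function `g = conj((1 − 1/s₀)u^{s₀−1})` on `(0,1]`,
`g = conj(−1/(s₀u))` on `(1,∞)` (that is, `V*` of the kernel of `h ↦ ĥ(s₀)` on `ℍ²`) is
square-integrable and orthogonal to every `E(φ)` by the split continuation
`(s−1)∫_0^1 E(φ)u^{s−1} + ∫_0^∞φ = ζ₁(s)φ̂(s)` (`Burnol2001.IsTest.mellin_indicator_mapE_eq`) at
`s = s₀`; but by Poisson (`Burnol2001.IsTest.mapE_fourier_eq`) every `E(𝓕φ)` is the CONSTANT
`−∫_0^∞φ` on `(0,1)`, and pairing `g − E(𝓕φ)` with `u − ½` on `(0,1)` gives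
`|(s₀−1)²/(2s₀²(s₀+1))| ≤ ε` for every `ε > 0`, absurd; `quasiRiemannHypothesis_one_half_iff_holds`
finishes. [cite: Burnol2001, Thm 2.8 (arXiv v3 l.500–519)] -/
theorem riemannHypothesis_of_causality
    (h : ∀ g : ℝ → ℂ, MemLp g 2 (volume.restrict (Ioi (0 : ℝ))) →
      (∀ φ : ℝ → ℂ, IsTest φ → ∫ u in Ioi (0 : ℝ), (starRingEnd ℂ) (mapE φ u) * g u = 0) →
      ∀ ε : ℝ, 0 < ε → ∃ φ : ℝ → ℂ, IsTest φ ∧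
        eLpNorm (fun u : ℝ ↦ g u - mapE (𝓕 φ) u) 2 (volume.restrict (Ioi (0 : ℝ))) <
          ENNReal.ofReal ε) :
    RiemannHypothesis := by
  refine quasiRiemannHypothesis_one_half_iff_holds.1 fun s hζ hσ hσ1 ↦ ?_
  set μ0 : Measure ℝ := volume.restrict (Ioi (0 : ℝ)) with hμ0
  set μ1 : Measure ℝ := volume.restrict (Ioo (0 : ℝ) 1) with hμ1
  have hre : 0 < s.re := by linarith
  have hs0 : s ≠ 0 := fun h0 ↦ by simp [h0] at hre
  have hs1 : s ≠ 1 := fun h1 ↦ by simp [h1] at hσ1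
  have hs1' : s - 1 ≠ 0 := sub_ne_zero.2 hs1
  have hsp1 : s + 1 ≠ 0 := by
    intro h0
    have := congrArg Complex.re h0
    simp only [add_re, one_re, zero_re] at this
    linarith
  -- `ζ₁(s) = 0`
  have hz : riemannZeta₁ s = 0 := by
    have h' := riemannZeta_eq_inv_sub_mul hs1
    rw [hζ] at h'
    rcases mul_eq_zero.1 h'.symm with h'' | h''
    · exact absurd h'' (inv_ne_zero hs1')
    · exact h''
  -- the witness `g = conj g₀`
  set a : ℂ := 1 - s⁻¹ with ha
  have ha' : a = (s - 1) / s := by rw [ha]; field_simp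
  set g₀ : ℝ → ℂ := fun u ↦ (Ioc (0 : ℝ) 1).indicator (fun u : ℝ ↦ a * (u : ℂ) ^ (s - 1)) u +
    (Ioi (1 : ℝ)).indicator (fun u : ℝ ↦ -(s * (u : ℂ))⁻¹) u with hg₀
  set g : ℝ → ℂ := fun u ↦ (starRingEnd ℂ) (g₀ u) with hg
  have hg₀m : Measurable g₀ := by
    refine Measurable.add ?_ ?_
    · exact ((Complex.measurable_ofReal.pow_const _).const_mul _).indicator measurableSet_Ioc
    · exact ((measurable_const.mul Complex.measurable_ofReal).inv.neg).indicator measurableSet_Ioi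
  have hgm : Measurable g := Complex.continuous_conj.measurable.comp hg₀m
  -- square-integrability
  have hg₀L2 : MemLp g₀ 2 μ0 := by
    refine MemLp.add ?_ ?_
    · have hbase : MemLp ((Ioc (0 : ℝ) 1).indicator fun x : ℝ ↦ (x : ℂ) ^ (s - 1)) 2 μ0 := by
        have hgm' : AEStronglyMeasurable ((Ioc (0 : ℝ) 1).indicator fun x : ℝ ↦ (x : ℂ) ^ (s - 1))
            μ0 := by
          refine (Measurable.indicator ?_ measurableSet_Ioc).aestronglyMeasurable
          exact Complex.measurable_ofReal.pow_const _
        refine (memLp_two_iff_integrable_sq_norm hgm').2 ?_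
        have hI : IntegrableOn (fun x : ℝ ↦ x ^ (2 * (s.re - 1))) (Ioc 0 1) μ0 :=
          (intervalIntegral.intervalIntegrable_rpow' (a := 0) (b := 1) (by linarith)).1.restrict
        refine (hI.integrable_indicator measurableSet_Ioc).congr ?_
        filter_upwards [ae_restrict_mem measurableSet_Ioi] with x (hx : 0 < x)
        by_cases hx1 : x ∈ Ioc (0 : ℝ) 1
        · simp only [indicator_of_mem hx1, norm_cpow_eq_rpow_re_of_pos hx, sub_re, one_re]
          rw [← Real.rpow_natCast, ← Real.rpow_mul hx.le]
          norm_num [mul_comm]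
        · simp [indicator_of_notMem hx1]
      have e1 : ((Ioc (0 : ℝ) 1).indicator fun u : ℝ ↦ a * (u : ℂ) ^ (s - 1)) =
          fun u ↦ a * (Ioc (0 : ℝ) 1).indicator (fun x : ℝ ↦ (x : ℂ) ^ (s - 1)) u := by
        funext u
        by_cases hu : u ∈ Ioc (0 : ℝ) 1
        · simp only [indicator_of_mem hu]
        · simp only [indicator_of_notMem hu, mul_zero]
      rw [e1]
      exact hbase.const_mul a
    · have hgm' : AEStronglyMeasurable ((Ioi (1 : ℝ)).indicator fun u : ℝ ↦ -(s * (u : ℂ))⁻¹) μ0 :=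
        (((measurable_const.mul Complex.measurable_ofReal).inv.neg).indicator
          measurableSet_Ioi).aestronglyMeasurable
      refine (memLp_two_iff_integrable_sq_norm hgm').2 ?_
      have hI : IntegrableOn (fun x : ℝ ↦ (‖s‖ ^ 2)⁻¹ * x ^ (-2 : ℝ)) (Ioi 1) volume :=
        (integrableOn_Ioi_rpow_of_lt (by norm_num) zero_lt_one).const_mul _
      refine ((hI.integrable_indicator measurableSet_Ioi).restrict (s := Ioi 0)).congr ?_
      filter_upwards [ae_restrict_mem measurableSet_Ioi] with x (hx : 0 < x)
      by_cases hx1 : x ∈ Ioi (1 : ℝ)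
      · simp only [indicator_of_mem hx1, norm_neg, norm_inv, norm_mul, Complex.norm_real,
          Real.norm_eq_abs, abs_of_pos hx]
        rw [Real.rpow_neg hx.le, Real.rpow_two]
        field_simp
      · simp [indicator_of_notMem hx1]
  have hgL2 : MemLp g 2 μ0 :=
    hg₀L2.of_le hgm.aestronglyMeasurable (Eventually.of_forall fun u ↦ (Complex.norm_conj _).le)
  -- orthogonality to `E(𝒮_{≤1})`
  have horth : ∀ φ : ℝ → ℂ, IsTest φ →
      ∫ u in Ioi (0 : ℝ), (starRingEnd ℂ) (mapE φ u) * g u = 0 := by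
    intro φ hφ
    set c : ℂ := ∫ x in Ioi (0 : ℝ), φ x with hc
    have hsplit : ∀ u ∈ Ioi (0 : ℝ), mapE φ u * g₀ u =
        a * ((u : ℂ) ^ (s - 1) • (Ioc (0 : ℝ) 1).indicator (mapE φ) u) +
          (Ioi (1 : ℝ)).indicator (fun u : ℝ ↦ c / s * (((u ^ (-2 : ℝ) : ℝ)) : ℂ)) u := by
      intro u hu
      have hu0 : (0 : ℝ) < u := hu
      by_cases hu1 : u ≤ 1
      · have hmem : u ∈ Ioc (0 : ℝ) 1 := ⟨hu0, hu1⟩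
        have hnm : u ∉ Ioi (1 : ℝ) := fun h' ↦ absurd hu1 (not_le.2 h')
        simp only [hg₀, indicator_of_mem hmem, indicator_of_notMem hnm, add_zero, smul_eq_mul]
        ring
      · rw [not_le] at hu1
        have hnm : u ∉ Ioc (0 : ℝ) 1 := fun h' ↦ absurd h'.2 (not_le.2 hu1)
        have huc : (u : ℂ) ≠ 0 := by exact_mod_cast hu0.ne'
        simp only [hg₀, indicator_of_notMem hnm, indicator_of_mem (show u ∈ Ioi (1 : ℝ) from hu1),
          zero_add, smul_zero, mul_zero, hφ.mapE_eq_of_one_lt hu1, ← hc]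
        rw [Real.rpow_neg hu0.le, Real.rpow_two]
        push_cast
        field_simp
    have hint1 : Integrable (fun u : ℝ ↦ (u : ℂ) ^ (s - 1) • (Ioc (0 : ℝ) 1).indicator (mapE φ) u)
        μ0 := (hφ.hasMellin_indicator_mapE_aux hre).1
    have hint2' : IntegrableOn (fun u : ℝ ↦ c / s * (((u ^ (-2 : ℝ) : ℝ)) : ℂ)) (Ioi 1) volume :=
      ((integrableOn_Ioi_rpow_of_lt (by norm_num : (-2 : ℝ) < -1) zero_lt_one).ofReal).const_mul
        (c / s)
    have hint2 : Integrable ((Ioi (1 : ℝ)).indicator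
        (fun u : ℝ ↦ c / s * (((u ^ (-2 : ℝ) : ℝ)) : ℂ))) μ0 :=
      (hint2'.integrable_indicator measurableSet_Ioi).restrict
    have hI : ∫ u in Ioi (0 : ℝ), mapE φ u * g₀ u = 0 := by
      rw [setIntegral_congr_fun measurableSet_Ioi hsplit, integral_add (hint1.const_mul a) hint2,
        integral_const_mul]
      have e1 : ∫ u in Ioi (0 : ℝ), (u : ℂ) ^ (s - 1) • (Ioc (0 : ℝ) 1).indicator (mapE φ) u =
          mellin ((Ioc (0 : ℝ) 1).indicator (mapE φ)) s := rfl
      have e2 : ∫ u in Ioi (0 : ℝ), (Ioi (1 : ℝ)).indicator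
          (fun u : ℝ ↦ c / s * (((u ^ (-2 : ℝ) : ℝ)) : ℂ)) u = c / s := by
        rw [setIntegral_indicator measurableSet_Ioi, Ioi_inter_Ioi, sup_of_le_right zero_le_one,
          integral_const_mul, integral_complex_ofReal,
          integral_Ioi_rpow_of_lt (by norm_num) zero_lt_one]
        norm_num
      rw [e1, e2]
      have key := hφ.mellin_indicator_mapE_eq hre
      rw [hz, zero_mul, ← hc] at key
      rw [ha']
      field_simp
      linear_combination key
    calc ∫ u in Ioi (0 : ℝ), (starRingEnd ℂ) (mapE φ u) * g u
        = ∫ u in Ioi (0 : ℝ), (starRingEnd ℂ) (mapE φ u * g₀ u) := by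
          refine setIntegral_congr_fun measurableSet_Ioi fun u _ ↦ ?_
          simp only [hg, map_mul]
      _ = (starRingEnd ℂ) (∫ u in Ioi (0 : ℝ), mapE φ u * g₀ u) := integral_conj
      _ = 0 := by rw [hI, map_zero]
  -- the contradiction constant
  set δ : ℝ := ‖(s - 1) ^ 2 / (2 * s ^ 2 * (s + 1))‖ with hδ
  have hδ0 : 0 < δ := norm_pos_iff.2 (div_ne_zero (pow_ne_zero _ hs1')
    (mul_ne_zero (mul_ne_zero two_ne_zero (pow_ne_zero _ hs0)) hsp1))
  -- integrals on `(0,1)` against `k(u) = u − ½`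
  set k : ℝ → ℂ := fun u ↦ (u : ℂ) - 1 / 2 with hk
  have hkm : Measurable k := Complex.measurable_ofReal.sub_const _
  have hk1 : eLpNorm k 2 μ1 ≤ 1 := by
    have hb : ∀ᵐ u ∂μ1, ‖k u‖ ≤ 1 := by
      filter_upwards [ae_restrict_mem measurableSet_Ioo] with u hu
      have : k u = ((u - 1 / 2 : ℝ) : ℂ) := by rw [hk]; push_cast; ring
      rw [this, Complex.norm_real, Real.norm_eq_abs, abs_le]
      constructor <;> linarith [hu.1, hu.2]
    refine (eLpNorm_le_of_ae_bound hb).trans ?_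
    rw [Measure.restrict_apply_univ, Real.volume_Ioo]
    norm_num
  have hcpow1 : IntegrableOn (fun x : ℝ ↦ (x : ℂ) ^ (s - 1)) (Ioo 0 1) volume :=
    (intervalIntegral.intervalIntegrable_cpow' (a := 0) (b := 1)
      (by simp only [sub_re, one_re]; linarith)).1.mono_set Ioo_subset_Ioc_self
  have hcpow0 : IntegrableOn (fun x : ℝ ↦ (x : ℂ) ^ s) (Ioo 0 1) volume :=
    (intervalIntegral.intervalIntegrable_cpow' (a := 0) (b := 1) (by linarith)).1.mono_set
      Ioo_subset_Ioc_self
  have hI1 : ∫ u in Ioo (0 : ℝ) 1, (u : ℂ) ^ (s - 1) = 1 / s := by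
    rw [setIntegral_congr_set Ioo_ae_eq_Ioc, ← intervalIntegral.integral_of_le zero_le_one,
      integral_cpow (Or.inl (by simp only [sub_re, one_re]; linarith))]
    rw [sub_add_cancel, Complex.ofReal_one, one_cpow, Complex.ofReal_zero, zero_cpow hs0]
    ring
  have hI0' : ∫ u in Ioo (0 : ℝ) 1, (u : ℂ) ^ s = 1 / (s + 1) := by
    rw [setIntegral_congr_set Ioo_ae_eq_Ioc, ← intervalIntegral.integral_of_le zero_le_one,
      integral_cpow (Or.inl (by linarith))]
    rw [Complex.ofReal_one, one_cpow, Complex.ofReal_zero, zero_cpow hsp1]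
    ring
  have hpow : ∀ u ∈ Ioo (0 : ℝ) 1, (u : ℂ) ^ s = (u : ℂ) ^ (s - 1) * u := by
    intro u hu
    have huc : (u : ℂ) ≠ 0 := by exact_mod_cast hu.1.ne'
    conv_lhs => rw [show s = (s - 1) + 1 by ring]
    rw [cpow_add _ _ huc, cpow_one]
  have hkeq : (fun u ↦ k u * (a * (u : ℂ) ^ (s - 1))) =ᵐ[μ1]
      fun u ↦ a * (u : ℂ) ^ s - a / 2 * (u : ℂ) ^ (s - 1) := by
    filter_upwards [ae_restrict_mem measurableSet_Ioo] with u hu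
    rw [hpow u hu, hk]
    ring
  have hkint : Integrable (fun u ↦ k u * (a * (u : ℂ) ^ (s - 1))) μ1 :=
    ((hcpow0.const_mul a).sub (hcpow1.const_mul (a / 2))).congr hkeq.symm
  have hkI : ∫ u in Ioo (0 : ℝ) 1, k u * (a * (u : ℂ) ^ (s - 1)) =
      a * ((s - 1) / (2 * s * (s + 1))) := by
    rw [integral_congr_ae hkeq, integral_sub (hcpow0.const_mul a) (hcpow1.const_mul (a / 2)),
      integral_const_mul, integral_const_mul, hI0', hI1]
    field_simp
    ring
  have hkc : Continuous k := by rw [hk]; fun_prop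
  have hkint0 : Integrable k μ1 := (hkc.intervalIntegrable 0 1).1.mono_set Ioo_subset_Ioc_self
  have hkI0 : ∫ u in Ioo (0 : ℝ) 1, k u = 0 := by
    rw [setIntegral_congr_set Ioo_ae_eq_Ioc, ← intervalIntegral.integral_of_le zero_le_one, hk,
      intervalIntegral.integral_sub (Complex.continuous_ofReal.intervalIntegrable 0 1)
        (continuous_const.intervalIntegrable 0 1), intervalIntegral.integral_ofReal,
      integral_id, intervalIntegral.integral_const]
    norm_num
  -- Key: for every `ε > 0`, `δ ≤ ε`.
  have key : ∀ ε : ℝ, 0 < ε → δ ≤ ε := by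
    intro ε hε
    obtain ⟨φ, hφ, hN⟩ := h g hgL2 horth ε hε
    set c : ℂ := ∫ x in Ioi (0 : ℝ), φ x with hc
    -- on `(0,1)`: `g − E(𝓕φ) = conj(a u^{s−1}) + c`
    set D : ℝ → ℂ := fun u ↦ (starRingEnd ℂ) (a * (u : ℂ) ^ (s - 1)) + c with hD
    have hDm : Measurable D :=
      (Complex.continuous_conj.measurable.comp
        ((Complex.measurable_ofReal.pow_const _).const_mul _)).add_const _
    have hae : (fun u : ℝ ↦ g u - mapE (𝓕 φ) u) =ᵐ[μ1] D := by
      filter_upwards [ae_restrict_mem measurableSet_Ioo] with u hu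
      have hu0 : (0 : ℝ) < u := hu.1
      have hmem : u ∈ Ioc (0 : ℝ) 1 := ⟨hu.1, hu.2.le⟩
      have hnm : u ∉ Ioi (1 : ℝ) := fun h' ↦ absurd (mem_Ioi.1 h') (not_lt.2 hu.2.le)
      have hinv : 1 < u⁻¹ := (one_lt_inv₀ hu0).2 hu.2
      have huc : (u : ℂ) ≠ 0 := by exact_mod_cast hu0.ne'
      rw [hφ.mapE_fourier_eq hu0, hφ.mapE_eq_of_one_lt hinv]
      simp only [hg, hg₀, hD, indicator_of_mem hmem, indicator_of_notMem hnm, add_zero, ← hc,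
        Complex.ofReal_inv]
      field_simp
      ring
    have hD1 : eLpNorm D 2 μ1 < ENNReal.ofReal ε := by
      rw [← eLpNorm_congr_ae hae]
      exact (eLpNorm_mono_measure _ (Measure.restrict_mono_set _ Ioo_subset_Ioi_self)).trans_lt hN
    have hD2 : MemLp D 2 μ1 := ⟨hDm.aestronglyMeasurable, hD1.trans ENNReal.ofReal_lt_top⟩
    have hk2 : MemLp k 2 μ1 := ⟨hkm.aestronglyMeasurable, hk1.trans_lt ENNReal.one_lt_top⟩
    have hkD : Integrable (fun u ↦ k u * D u) μ1 := memLp_one_iff_integrable.1 (hD2.mul' hk2)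
    -- value of the pairing `∫_0^1 k D = conj(a (s−1)/(2s(s+1)))`
    have hkconj : ∀ u : ℝ, (starRingEnd ℂ) (k u) = k u := by
      intro u
      simp only [hk, map_sub, Complex.conj_ofReal, map_div₀, map_one, map_ofNat]
    have e1 : ∀ u : ℝ, k u * D u =
        (starRingEnd ℂ) (k u * (a * (u : ℂ) ^ (s - 1))) + c * k u := by
      intro u
      rw [hD, map_mul, hkconj]
      ring
    have hi2 : Integrable (fun u ↦ c * k u) μ1 := hkint0.const_mul c
    have hi1 : Integrable (fun u ↦ (starRingEnd ℂ) (k u * (a * (u : ℂ) ^ (s - 1)))) μ1 := by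
      refine (hkD.sub hi2).congr (Eventually.of_forall fun u ↦ ?_)
      simp only [Pi.sub_apply, e1 u, add_sub_cancel_right]
    have hval : ∫ u in Ioo (0 : ℝ) 1, k u * D u =
        (starRingEnd ℂ) (a * ((s - 1) / (2 * s * (s + 1)))) := by
      simp_rw [e1]
      rw [integral_add hi1 hi2, integral_conj, hkI, integral_const_mul, hkI0, mul_zero, add_zero]
    -- Hölder bound `|∫_0^1 k D| ≤ ε`
    have hH : eLpNorm (D • k) 1 μ1 ≤ ENNReal.ofReal ε * 1 := by
      calc eLpNorm (D • k) 1 μ1 ≤ eLpNorm D 2 μ1 * eLpNorm k 2 μ1 :=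
            eLpNorm_smul_le_mul_eLpNorm hkm.aestronglyMeasurable hDm.aestronglyMeasurable
        _ ≤ ENNReal.ofReal ε * 1 := by gcongr
    have hfin : ENNReal.ofReal ε * 1 ≠ ⊤ := ENNReal.mul_ne_top ENNReal.ofReal_ne_top ENNReal.one_ne_top
    have hle : ‖∫ u in Ioo (0 : ℝ) 1, k u * D u‖ ≤ ε := by
      calc ‖∫ u in Ioo (0 : ℝ) 1, k u * D u‖
          = ‖∫ u in Ioo (0 : ℝ) 1, (D • k) u‖ := by
            congr 1
            refine integral_congr_ae (Eventually.of_forall fun u ↦ ?_)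
            simp only [Pi.smul_apply', smul_eq_mul]
            ring
        _ ≤ (∫⁻ u in Ioo (0 : ℝ) 1, ENNReal.ofReal ‖(D • k) u‖).toReal :=
            norm_integral_le_lintegral_norm _
        _ = (eLpNorm (D • k) 1 μ1).toReal := by
            rw [eLpNorm_one_eq_lintegral_enorm]
            simp_rw [ofReal_norm]
            rfl
        _ ≤ (ENNReal.ofReal ε * 1).toReal := ENNReal.toReal_mono hfin hH
        _ = ε := by rw [mul_one, ENNReal.toReal_ofReal hε.le]
    have hδval : δ = ‖∫ u in Ioo (0 : ℝ) 1, k u * D u‖ := by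
      rw [hval, Complex.norm_conj, hδ, ha']
      congr 1
      field_simp
    rw [hδval]
    exact hle
  have := key (δ / 2) (by positivity)
  linarith

/-- DISCHARGE of the named fact **Burnol 2001, Thm 2.8** (the `ζ`-case of the causality
criterion Thm 1.7): `E(𝒮_{≤1})^⊥ ⊂ cl E(𝓕(𝒮_{≤1})) ⟺ RH`, proved AS AN EQUIVALENCE (neither side
asserted): `⟹` is `riemannHypothesis_of_causality`, `⟸` is
`causality_closure_of_riemannHypothesis`. [cite: Burnol2001, Thm 2.8 (arXiv v3 l.516–519)] -/
theorem Burnol2001_thm_2_8_holds : Burnol2001_thm_2_8 :=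
  ⟨riemannHypothesis_of_causality, causality_closure_of_riemannHypothesis⟩

end Literature.NumberTheory.LFunctions

end
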